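import Mathlib
import Summits.ValiantsHypothesis.ValiantsHypothesis.Theorems.FeketeSOSCharPSparseSOSStubDictionaryAtInfinity

/-!
# Crux `FeketeSOS.CharPSparseSOS` (stmt-ValiantsHypothesis-14989), line `Sketch` — stub `stub_weylSymmetry`

Weyl symmetry of the two cusps.  Read a polynomial `P` of degree `< p` over a field `K` of
characteristic `p` as its coefficient function `h : 𝔽_p → K`.  The Weyl element acts by
`(w h)(n) = h(-1/n)` for `n ≠ 0` and `(w h)(0) = -Σ_m h(m)`; the polynomial `W` with coefficient
function `w h` satisfies

* `(X - 1)^D ∣ P` iff `W` is deep `≥ D` at the lower cusp (`W_0 = 0` when `1 ≤ D`, and the top moments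
  `Σ_{n<p} W_n n^{p-1-d}` vanish for `1 ≤ d < D`);
* `#supp W ≤ #supp P + 1`.

Proof.  The index map `σ(n) = -1/n` (read in `ℕ` through `ZMod.val`) is an involution of
`{1, …, p-1}` with `(σ n : K) = -(n : K)⁻¹`.  For `1 ≤ d ≤ p-2` the `n = 0` term of the top moment
drops and, substituting `m = σ n` and using Fermat (`n^{p-1-d} = (n^d)⁻¹` as `n^{p-1} = 1`),
`Σ_{n<p} W_n n^{p-1-d} = (-1)^d Σ_{m<p} P_m m^d`; for exponent `0` one gets `Σ_{n<p} W_n = -P_0`;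
and `W_0 = -Σ_m P_m`.  For `D < p` the claim is then the landed dictionary at `∞`
(`stub_dictionaryAtInfinity`).  For `D ≥ p` both sides force `P = 0`: the left by degree, the right
because it makes all moments `μ_0, …, μ_{p-1}` of `P` vanish (`μ_{p-1} = Σ_{0<m<p} P_m = μ_0 - P_0`
by Fermat), whence `(X-1)^p ∣ P` by the dictionary.  The support bound is
`supp W ⊆ {0} ∪ σ(supp P)`.
-/

-- `Summit.ValiantsHypothesis.ValiantsHypothesis.…` is the tree's mandated single-conjunct layout (Sub = Summit).
set_option linter.dupNamespace false

namespace Summit.ValiantsHypothesis.ValiantsHypothesis.Theorems.CharPSparseSOSTwoCusp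

open Polynomial Finset

section Helpers

variable {K : Type*} [Field K] (p : ℕ) [Fact p.Prime]

/-- Coefficients of the Weyl-transformed polynomial `W = Σ_{n<p} C (w h)(n) X^n`. -/
theorem ws_coeff (P : K[X]) (k : ℕ) :
    (∑ n ∈ Finset.range p, C (if n = 0 then -(∑ m ∈ Finset.range p, P.coeff m)
        else P.coeff ((-((n : ZMod p)⁻¹)).val)) * X ^ n).coeff k =
      if k < p then (if k = 0 then -(∑ m ∈ Finset.range p, P.coeff m)
        else P.coeff ((-((k : ZMod p)⁻¹)).val)) else 0 := by
  simp only [finsetSum_coeff, coeff_C_mul_X_pow, Finset.sum_ite_eq, Finset.mem_range]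

/-- The Weyl index map `σ(n) = -1/n` (read in `ℕ` through `ZMod.val`) is an involution on
`{0, …, p-1}`. -/
theorem ws_sigma_sigma (n : ℕ) (hn : n < p) :
    (-((((-((n : ZMod p)⁻¹)).val : ℕ) : ZMod p)⁻¹)).val = n := by
  rw [ZMod.natCast_zmod_val, inv_neg, neg_neg, inv_inv, ZMod.val_cast_of_lt hn]

/-- The Weyl index map preserves `{1, …, p-1}`. -/
theorem ws_sigma_mem (n : ℕ) (hn : n ∈ (Finset.range p).erase 0) :
    (-((n : ZMod p)⁻¹)).val ∈ (Finset.range p).erase 0 := by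
  rw [mem_erase, mem_range] at hn ⊢
  refine ⟨?_, ZMod.val_lt _⟩
  rw [Ne, ZMod.val_eq_zero, neg_eq_zero, inv_eq_zero, ZMod.natCast_eq_zero_iff]
  exact Nat.not_dvd_of_pos_of_lt (Nat.pos_of_ne_zero hn.1) hn.2

/-- Re-indexing a sum over `{1, …, p-1}` along the Weyl involution. -/
theorem ws_sum_reindex (g : ℕ → K) :
    ∑ n ∈ (Finset.range p).erase 0, g ((-((n : ZMod p)⁻¹)).val) =
      ∑ n ∈ (Finset.range p).erase 0, g n := by
  refine Finset.sum_nbij' (fun n => (-((n : ZMod p)⁻¹)).val)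
    (fun n => (-((n : ZMod p)⁻¹)).val) (ws_sigma_mem p) (ws_sigma_mem p)
    (fun n hn => ws_sigma_sigma p n ?_) (fun n hn => ws_sigma_sigma p n ?_) fun n _ => rfl
  · exact mem_range.mp (mem_of_mem_erase hn)
  · exact mem_range.mp (mem_of_mem_erase hn)

variable [CharP K p]

/-- In `K`, the Weyl index map is `n ↦ -(n)⁻¹`. -/
theorem ws_cast_sigma (n : ℕ) : (((-((n : ZMod p)⁻¹)).val : ℕ) : K) = -((n : K)⁻¹) := by
  have h := map_natCast (ZMod.castHom (dvd_refl p) K) ((-((n : ZMod p)⁻¹)).val)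
  rw [ZMod.natCast_zmod_val, map_neg, map_inv₀, map_natCast] at h
  exact h.symm

/-- Negative powers through Fermat: for `0 < n < p` and `d ≤ p - 1`, `n^{p-1-d} = (n^d)⁻¹` in `K`
(`n^{p-1} = 1`, i.e. `ZMod.pow_card_sub_one_eq_one` transported along `ZMod.castHom`). [folklore] -/
theorem ws_natCast_pow_sub_eq_inv (n d : ℕ) (h0 : 0 < n) (hlt : n < p) (hd : d ≤ p - 1) :
    (n : K) ^ (p - 1 - d) = ((n : K) ^ d)⁻¹ := by
  have hne : (n : ZMod p) ≠ 0 := by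
    rw [Ne, ZMod.natCast_eq_zero_iff]
    exact Nat.not_dvd_of_pos_of_lt h0 hlt
  have h := congrArg (ZMod.castHom (dvd_refl p) K) (ZMod.pow_card_sub_one_eq_one hne)
  rw [map_pow, map_natCast, map_one] at h
  refine eq_inv_of_mul_eq_one_left ?_
  rw [← pow_add, Nat.sub_add_cancel hd, h]

end Helpers

/-- **Weyl symmetry of the two cusps.** For `deg P < p = char K` (`p` odd) and `W` the Weyl
transform of `P` (`W_n = P_{-1/n}` for `0 < n < p`, `W_0 = -Σ_m P_m`): `(X - 1)^D ∣ P` iff `W` is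
deep `≥ D` at the lower cusp, and `#supp W ≤ #supp P + 1`. -/
theorem stub_weylSymmetry :
    ∀ (K : Type) [Field K] (p : ℕ) [Fact p.Prime] [CharP K p] (P W : K[X]) (D : ℕ),
      p ≠ 2 → P.natDegree < p →
        W = ∑ n ∈ Finset.range p,
              C (if n = 0 then -(∑ m ∈ Finset.range p, P.coeff m)
                 else P.coeff ((-((n : ZMod p)⁻¹)).val)) * X ^ n →
          (((X - C (1 : K)) ^ D ∣ P ↔
              ((1 ≤ D → W.coeff 0 = 0) ∧
                ∀ d : ℕ, 1 ≤ d → d < D →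
                  ∑ n ∈ Finset.range p, W.coeff n * (n : K) ^ (p - 1 - d) = 0)) ∧
            W.support.card ≤ P.support.card + 1) := by
  intro K _ p _ _ P W D _ hdeg hW
  have hp : p.Prime := Fact.out
  have h2 := hp.two_le
  have h0mem : 0 ∈ range p := mem_range.mpr hp.pos
  -- the coefficients of `W`
  have hWc : ∀ k, W.coeff k = if k < p then (if k = 0 then -(∑ m ∈ range p, P.coeff m)
      else P.coeff ((-((k : ZMod p)⁻¹)).val)) else 0 := fun k => by
    rw [hW]; exact ws_coeff p P k
  have hW0 : W.coeff 0 = -∑ m ∈ range p, P.coeff m := by rw [hWc, if_pos hp.pos, if_pos rfl]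
  have hWn : ∀ n ∈ (range p).erase 0, W.coeff n = P.coeff ((-((n : ZMod p)⁻¹)).val) := by
    intro n hn
    rw [mem_erase, mem_range] at hn
    rw [hWc, if_pos hn.2, if_neg hn.1]
  -- the trivial case `P = 0` (then `W = 0`)
  rcases eq_or_ne P 0 with rfl | hP
  · have hW' : W = 0 := by rw [hW]; simp
    subst hW'
    simp
  -- top moments of `W` of positive exponent `p-1-d`, `1 ≤ d ≤ p-2`, are `(-1)^d μ_d(P)`
  have hS1 : ∀ d, 1 ≤ d → d < p - 1 →
      ∑ n ∈ range p, W.coeff n * (n : K) ^ (p - 1 - d)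
        = (-1) ^ d * ∑ n ∈ range p, P.coeff n * (n : K) ^ d := by
    intro d hd1 hdp
    calc ∑ n ∈ range p, W.coeff n * (n : K) ^ (p - 1 - d)
        = ∑ n ∈ (range p).erase 0, W.coeff n * (n : K) ^ (p - 1 - d) := by
          refine (sum_erase (range p) ?_).symm
          show W.coeff 0 * ((0 : ℕ) : K) ^ (p - 1 - d) = 0
          rw [Nat.cast_zero, zero_pow (by omega), mul_zero]
      _ = ∑ n ∈ (range p).erase 0, P.coeff ((-((n : ZMod p)⁻¹)).val)
            * (-((((-((n : ZMod p)⁻¹)).val : ℕ) : K))) ^ d := by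
          refine sum_congr rfl fun n hn => ?_
          have hn' := hn
          rw [mem_erase, mem_range] at hn'
          rw [hWn n hn, ws_cast_sigma p n, neg_neg, inv_pow,
            ws_natCast_pow_sub_eq_inv p n d (Nat.pos_of_ne_zero hn'.1) hn'.2 (by omega)]
      _ = ∑ n ∈ (range p).erase 0, P.coeff n * (-(n : K)) ^ d :=
          ws_sum_reindex p fun m => P.coeff m * (-(m : K)) ^ d
      _ = ∑ n ∈ range p, P.coeff n * (-(n : K)) ^ d := by
          refine sum_erase (range p) ?_
          show P.coeff 0 * (-(((0 : ℕ) : K))) ^ d = 0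
          rw [Nat.cast_zero, neg_zero, zero_pow (by omega), mul_zero]
      _ = (-1) ^ d * ∑ n ∈ range p, P.coeff n * (n : K) ^ d := by
          rw [mul_sum]
          refine sum_congr rfl fun n _ => ?_
          rw [neg_pow]
          ring
  -- top moments of `W` of exponent `0` (`d ≥ p-1`) equal `-P_0`
  have hS2 : ∀ d, p - 1 ≤ d →
      ∑ n ∈ range p, W.coeff n * (n : K) ^ (p - 1 - d) = -P.coeff 0 := by
    intro d hd
    have he : p - 1 - d = 0 := Nat.sub_eq_zero_of_le hd
    simp_rw [he, pow_zero, mul_one]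
    have h1 : ∑ n ∈ (range p).erase 0, W.coeff n = ∑ n ∈ (range p).erase 0, P.coeff n :=
      calc ∑ n ∈ (range p).erase 0, W.coeff n
          = ∑ n ∈ (range p).erase 0, P.coeff ((-((n : ZMod p)⁻¹)).val) := sum_congr rfl hWn
        _ = ∑ n ∈ (range p).erase 0, P.coeff n := ws_sum_reindex p P.coeff
    have h3 := add_sum_erase (range p) W.coeff h0mem
    have h4 := add_sum_erase (range p) P.coeff h0mem
    rw [hW0] at h3
    linear_combination h1 - h3 + h4
  refine ⟨?_, ?_⟩
  · rcases Nat.lt_or_ge D p with hDp | hpD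
    · -- `D < p`: the dictionary at `∞`
      rw [stub_dictionaryAtInfinity K p P D hdeg hDp.le]
      constructor
      · intro h
        refine ⟨fun hD1 => ?_, fun d hd1 hdD => ?_⟩
        · rw [hW0, neg_eq_zero]
          simpa using h 0 hD1
        · rw [hS1 d hd1 (by omega), h d hdD, mul_zero]
      · rintro ⟨h0, hd⟩ a haD
        rcases Nat.eq_zero_or_pos a with rfl | ha1
        · have := h0 haD
          rw [hW0, neg_eq_zero] at this
          simpa using this
        · have := hd a ha1 haD
          rw [hS1 a ha1 (by omega), mul_eq_zero] at this
          exact this.resolve_left (pow_ne_zero _ (neg_ne_zero.mpr one_ne_zero))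
    · -- `p ≤ D`: both sides fail for `P ≠ 0`
      refine iff_of_false (fun hdvd => ?_) (fun ⟨h0, hd⟩ => ?_)
      · have := natDegree_le_of_dvd hdvd hP
        rw [natDegree_pow, natDegree_X_sub_C, mul_one] at this
        omega
      · have hμ0 : ∑ m ∈ range p, P.coeff m = 0 := by
          have := h0 (by omega)
          rwa [hW0, neg_eq_zero] at this
        have hP0 : P.coeff 0 = 0 := by
          have := hd (p - 1) (by omega) (by omega)
          rwa [hS2 (p - 1) le_rfl, neg_eq_zero] at this
        have hall : ∀ a, a < p → ∑ n ∈ range p, P.coeff n * (n : K) ^ a = 0 := by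
          intro a hap
          rcases Nat.eq_zero_or_pos a with rfl | ha1
          · simpa using hμ0
          rcases Nat.lt_or_ge a (p - 1) with hap' | hap'
          · have := hd a ha1 (by omega)
            rw [hS1 a ha1 hap', mul_eq_zero] at this
            exact this.resolve_left (pow_ne_zero _ (neg_ne_zero.mpr one_ne_zero))
          · obtain rfl : a = p - 1 := by omega
            calc ∑ n ∈ range p, P.coeff n * (n : K) ^ (p - 1)
                = ∑ n ∈ (range p).erase 0, P.coeff n * (n : K) ^ (p - 1) := by
                  refine (sum_erase (range p) ?_).symm
                  show P.coeff 0 * ((0 : ℕ) : K) ^ (p - 1) = 0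
                  rw [hP0, zero_mul]
              _ = ∑ n ∈ (range p).erase 0, P.coeff n := by
                  refine sum_congr rfl fun n hn => ?_
                  rw [mem_erase, mem_range] at hn
                  have h := ws_natCast_pow_sub_eq_inv (K := K) p n 0 (Nat.pos_of_ne_zero hn.1) hn.2
                    p.pred.zero_le
                  rw [Nat.sub_zero, pow_zero, inv_one] at h
                  rw [h, mul_one]
              _ = ∑ n ∈ range p, P.coeff n := sum_erase (range p) hP0
              _ = 0 := hμ0
        have hdvd := (stub_dictionaryAtInfinity K p P p hdeg le_rfl).mpr hall
        have := natDegree_le_of_dvd hdvd hP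
        rw [natDegree_pow, natDegree_X_sub_C, mul_one] at this
        omega
  · -- support bound: `supp W ⊆ {0} ∪ σ(supp P)`
    have hsub :
        W.support ⊆ insert 0 (P.support.image fun m : ℕ => (-((m : ZMod p)⁻¹)).val) := by
      intro n hn
      rw [mem_support_iff, hWc] at hn
      rw [mem_insert, mem_image]
      by_cases hnp : n < p
      · rw [if_pos hnp] at hn
        by_cases hn0 : n = 0
        · exact Or.inl hn0
        · rw [if_neg hn0] at hn
          exact Or.inr ⟨_, mem_support_iff.mpr hn, ws_sigma_sigma p n hnp⟩
      · rw [if_neg hnp] at hn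
        exact absurd rfl hn
    calc W.support.card
        ≤ (insert 0 (P.support.image fun m : ℕ => (-((m : ZMod p)⁻¹)).val)).card :=
          card_le_card hsub
      _ ≤ (P.support.image fun m : ℕ => (-((m : ZMod p)⁻¹)).val).card + 1 :=
          card_insert_le _ _
      _ ≤ P.support.card + 1 := Nat.add_le_add_right card_image_le 1

end Summit.ValiantsHypothesis.ValiantsHypothesis.Theorems.CharPSparseSOSTwoCusp
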